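import Literature.InformationTheory.QuantumCodes.SyndromeDecodingCSS
import Literature.InformationTheory.QuantumCodes.SyndromeDecodingAdditive
import Literature.InformationTheory.QuantumCodes.CSSStabilizer
import Literature.InformationTheory.QuantumCodes.ExtremalTypeIIWeightEnumerators
import HarnessLib

/-!
# Zero-rate codes (stabilizer states, `k = 0`): minimum-weight syndrome decoding corrects EVERY error

Topic `Literature/InformationTheory/QuantumCodes`, namespace `Literature.InformationTheory.QuantumCodes` (venture QEC,
LADDER-QEC cell `qec`, PARTITION row 08, «08.ZERO»: the Q4 radius column of the census's `k = 0` rows). Theorem-only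
companion of `SyndromeDecoding.lean` / `SyndromeDecodingCSS.lean` / `SyndromeDecodingAdditive.lean` (decoders
`D : Syn → Err`, `D.Corrects syn S e ↔ D (syn e) + e ∈ S`, the canonical minimum-weight decoder `Decoder.minWeight`).

Gottesman 1997 §3.2 (held chunk p0018 L113–115): two errors have the same syndrome iff their product lies in `N(S)`, so
the syndrome determines the error up to `N(S)`; for a code with `k = 0` encoded qubits (`2^{n−k} = 2^n`, a single stabilizer
STATE — CRSS 1998 §2, printed p. 4: «an `[[n, 0, d]]` code is … a single quantum state») one has `N(S) = S`
(`dim S = n = dim S^⊥`), hence EVERY syndrome-consistent correction — in particular minimum-weight decoding — returns the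
state exactly: the correction radius is unbounded (every Pauli error of every weight is corrected up to a stabilizer). The
`[[n,k,d]]` radius `⌊(d−1)/2⌋` of `OptimalRadius.lean` has no meaning here (`d` of a `k = 0` code is the least nonzero
STABILIZER weight, a detection notion); this file supplies the honest radius-column entry «all».

* `CSSCode.minWeight_correctsUpToX_of_k_eq_zero`, `…Z…` — for a CSS code with `C.k = 0`, the canonical minimum-weight
  sector decoders correct every bit-flip and every phase-flip pattern (`ker H^Z = rs H^X`, `ker H^X = rs H^Z`);
* `CSSCode.k_eq_zero_of_isAdditiveCode_toSympCode` — the census's `k = 0` CSS rows are stated as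
  `IsAdditiveCode C.toSympCode 0 d`; this reads off `C.k = 0` (`finrank_toSympCode_add_k`);
* `CSSCode.minWeight_correctsAll_of_isAdditiveCode` — both sectors, every `t`, from that census statement;
* `AdditiveCode.minWeight_correctsUpTo_of_isAdditiveCode_zero` (via the tree's `IsAdditiveCode.sympDual_eq_self`,
  `ExtremalTypeIIWeightEnumerators.lean`: `S^⊥ = S` for an `[[n,0,d]]` code) — for generators `g` spanning `S` with `IsAdditiveCode S 0 d`,
  the canonical minimum-weight decoder of Gottesman's syndrome corrects every Pauli error of every symplectic weight.

All PROVED; no named fact, no `sorry`; no new definition. HONEST FRAMING: a bookkeeping statement (nothing is protected —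
there is no logical qubit); nothing probabilistic.

## References

* [Gottesman1997] D. Gottesman, Caltech thesis, §3.2 (held chunk p0018 L113–115: equal syndromes iff `E_a E_b ∈ N(S)`).
* [CalderbankEtAl1998] A. R. Calderbank, E. M. Rains, P. W. Shor, N. J. A. Sloane, IEEE Trans. IT 44 (1998) 1369, §2
  (printed p. 4: `[[n, 0, d]]` codes are single states; `d` = least nonzero stabilizer weight).
-/

namespace Literature.InformationTheory.QuantumCodes

open Matrix

namespace CSSCode

variable {RX RZ Q : Type*} [Fintype RX] [Fintype RZ] [Fintype Q]

omit [Fintype RZ] in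
/-- **`k = 0` ⇒ minimum-weight `X`-decoding corrects EVERY bit-flip pattern** (every weight `t`): with no logical qubit
`ker H^Z = rs H^X`, so every syndrome-consistent correction differs from the error by an `X`-stabilizer.
[cite: Gottesman1997, §3.2 (chunk p0018 L113-115: equal syndromes iff the product lies in N(S))] -/
theorem minWeight_correctsUpToX_of_k_eq_zero (C : CSSCode RX RZ Q) (hk : C.k = 0) (t : ℕ) :
    (Decoder.minWeight C.xSyndrome hammingNorm).CorrectsUpTo C.xSyndrome (C.rowSpX : Set (Q → ZMod 2)) hammingNorm t := by
  have hker : C.kerZ = C.rowSpX := C.dX_eq_zero_iff.1 (C.k_eq_zero_iff_dX_eq_zero.1 hk)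
  intro e _
  have h := (C.isMinWeight_minWeight_xSyndrome).add_mem e
  rw [hker] at h
  exact h

/-- **`k = 0` ⇒ minimum-weight `Z`-decoding corrects EVERY phase-flip pattern** (every weight `t`).
[cite: Gottesman1997, §3.2 (chunk p0018 L113-115)] -/
theorem minWeight_correctsUpToZ_of_k_eq_zero (C : CSSCode RX RZ Q) (hk : C.k = 0) (t : ℕ) :
    (Decoder.minWeight C.zSyndrome hammingNorm).CorrectsUpTo C.zSyndrome (C.rowSpZ : Set (Q → ZMod 2)) hammingNorm t := by
  have hdZ : C.dZ = 0 := C.dX_eq_zero_iff_dZ_eq_zero.1 (C.k_eq_zero_iff_dX_eq_zero.1 hk)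
  have hker : C.kerX = C.rowSpZ := C.swap.dX_eq_zero_iff.1 hdZ
  intro e _
  have h := (C.isMinWeight_minWeight_zSyndrome).add_mem e
  rw [hker] at h
  exact h

/-- The census states its `k = 0` CSS rows as `IsAdditiveCode C.toSympCode 0 d` (CRSS's convention); this reads off
`C.k = 0` (`dim S + k = n`). [cite: CalderbankEtAl1998, §2 (printed p. 4: [[n, 0, d]] codes)] -/
theorem k_eq_zero_of_isAdditiveCode_toSympCode {n : ℕ} (C : CSSCode RX RZ (Fin n)) {d : ℕ}
    (h : IsAdditiveCode C.toSympCode 0 d) : C.k = 0 := by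
  have h1 := C.finrank_toSympCode_add_k
  have h2 := h.2.1
  omega

/-- **Radius-column entry «all» of a `k = 0` CSS census row**: from `IsAdditiveCode C.toSympCode 0 d`, both canonical
minimum-weight sector decoders correct every pattern of every weight.
[cite: Gottesman1997, §3.2 (chunk p0018 L113-115)] [cite: CalderbankEtAl1998, §2 (printed p. 4)] -/
theorem minWeight_correctsAll_of_isAdditiveCode {n : ℕ} (C : CSSCode RX RZ (Fin n)) {d : ℕ}
    (h : IsAdditiveCode C.toSympCode 0 d) (t : ℕ) :
    (Decoder.minWeight C.xSyndrome hammingNorm).CorrectsUpTo C.xSyndrome (C.rowSpX : Set (Fin n → ZMod 2)) hammingNorm t ∧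
      (Decoder.minWeight C.zSyndrome hammingNorm).CorrectsUpTo C.zSyndrome (C.rowSpZ : Set (Fin n → ZMod 2)) hammingNorm t :=
  ⟨C.minWeight_correctsUpToX_of_k_eq_zero (C.k_eq_zero_of_isAdditiveCode_toSympCode h) t,
    C.minWeight_correctsUpToZ_of_k_eq_zero (C.k_eq_zero_of_isAdditiveCode_toSympCode h) t⟩

end CSSCode

namespace AdditiveCode

variable {n : ℕ}

/-- **`k = 0` ⇒ minimum-weight syndrome decoding corrects EVERY Pauli error** (every symplectic weight `t`): the canonical
minimum-weight decoder of Gottesman's syndrome (generators `g` spanning `S`, `IsAdditiveCode S 0 d`) returns a correction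
whose product with the error is undetectable, i.e. lies in `S^⊥ = S`.
[cite: Gottesman1997, §3.2 (chunk p0018 L113-115: equal syndromes iff E_a E_b ∈ N(S))] [cite: CalderbankEtAl1998, §2 (printed p. 4)] -/
theorem minWeight_correctsUpTo_of_isAdditiveCode_zero {ι : Type*} {g : ι → SympVec n}
    {S : Submodule (ZMod 2) (SympVec n)} (hg : Submodule.span (ZMod 2) (Set.range g) = S) {d : ℕ}
    (h : IsAdditiveCode S 0 d) (t : ℕ) :
    (Decoder.minWeight (sympSyndrome g) sympWeight).CorrectsUpTo (sympSyndrome g) (S : Set (SympVec n)) sympWeight t := by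
  intro e _
  have hm := (isMinWeight_minWeight_sympSyndrome g hg).add_mem e
  rw [h.sympDual_eq_self] at hm
  exact hm

end AdditiveCode

end Literature.InformationTheory.QuantumCodes
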